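import Summits.Parity.GeneralizedHardyLittlewood.Theorems.LeeYangFibresRelativeDimOneMoebiusSplitDefs
import Mathlib.Algebra.BigOperators.Ring.Finset
import Mathlib.Algebra.Order.Field.GeomSum
import Mathlib.Algebra.Order.Interval.Finset.SuccPred
import Mathlib.Order.Interval.Finset.Fin
import Mathlib.Algebra.BigOperators.Fin
import HarnessLib

/-!
# Route `LeeYangFibres`, crux `RelativeDimOne` (stmt-Parity-14113), line `single-moebius-split`:
# the assembly S2 (`stub_assembly`)

Registered stub `stub_assembly` of the checked skeleton
`Cruxes/RelativeDimOne/Lines/single_moebius_split.lean`: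
telescoping + T1 (`TruncatedMainTerm (k+1)`) + T0' (`MoebiusTermBound k`) + S1 (`TermBound k j η_j`
for every `j ≠ 0`) ⟹ the crux's `(k+1)`-slice `RelDimOneSlice (k+1)`.

Pure bookkeeping, fully proved:
* `prod_sub_prod_telescope` — the pointwise telescoping identity
  `∏_i a_i − ∏_i b_i = ∑_j (∏_{i<j} a_i)(a_j − b_j)(∏_{i>j} b_i)` over `Fin (k+1)`
  (from Mathlib's `Finset.prod_add_ordered`);
* `vonMangoldtSum_eq_truncCorrSum_add_sum` — hence
  `vonMangoldtSum Ψ K N = truncCorrSum Ψ K N R + ∑_j telescopeTermSum Ψ K N R j`;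
* `telescopeTermSum_zero'` — term `0` is `moebiusTermSum`;
* `stub_assembly` — geometric level exponents `δ_i = (1/8) x^i`, `x = 1/(c+1)`, `c = 2 + ∑_j 1/η_j`
  (so `StaggeredBy c δ`, hence `StaggeredBy 2 δ` and `StaggeredBy (2 + 1/η_j) δ` for every `j` by
  `staggeredBy_mono`, `2∑_{i≥1} δ_i < δ_0`, `∑ δ_i ≤ 3/16 ≤ 1/4`), thresholds by `max`/`Finset.sup`,
  and `ε/3` bookkeeping with `β_∞𝔖 ≥ 0` (`mass_nonneg`).
-/

noncomputable section

open scoped BigOperators Classical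
open Filter Finset Literature.NumberTheory.Sieve

namespace Summit.Parity.GeneralizedHardyLittlewood.Cruxes.RelativeDimOne.SingleMoebiusSplit

/-- **Pointwise telescoping.** For `a b : Fin (k+1) → ℝ`,
`∏_i a_i − ∏_i b_i = ∑_j (∏_{i<j} a_i)(a_j − b_j)(∏_{i>j} b_i)` (Mathlib's `Finset.prod_add_ordered`
with `f = b`, `g = a − b`). -/
theorem prod_sub_prod_telescope {k : ℕ} (a b : Fin (k + 1) → ℝ) :
    ∏ i, a i - ∏ i, b i =
      ∑ j, (∏ i ∈ Finset.Iio j, a i) * (a j - b j) * ∏ i ∈ Finset.Ioi j, b i := by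
  have h := Finset.prod_add_ordered Finset.univ b (fun i => a i - b i)
  simp only [add_sub_cancel, Finset.filter_lt_eq_Ioi, Finset.filter_gt_eq_Iio] at h
  rw [h, add_sub_cancel_left]
  exact Finset.sum_congr rfl fun j _ => by ring

/-- **The telescoping of the correlation sum**: every factor `Λ = Λ_{R_i} + (Λ − Λ_{R_i})`, so
`∑_{n} ∏_i Λ(ψ_i(n)) = ∑_n ∏_i Λ_{R_i}(ψ_i(n)) + ∑_j ∑_n [∏_{i<j} Λ][Λ − Λ_{R_j}][∏_{i>j} Λ_{R_i}]`,
i.e. `vonMangoldtSum = truncCorrSum + ∑_j telescopeTermSum … j`. -/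
theorem vonMangoldtSum_eq_truncCorrSum_add_sum {k : ℕ} (Ψ : Fin (k + 1) → AffLinForm 1)
    (K : Set (Fin 1 → ℝ)) (N : ℕ) (R : Fin (k + 1) → ℝ) :
    vonMangoldtSum Ψ K N = truncCorrSum Ψ K N R + ∑ j, telescopeTermSum Ψ K N R j := by
  unfold vonMangoldtSum truncCorrSum telescopeTermSum
  rw [Finset.sum_comm, ← Finset.sum_add_distrib]
  refine Finset.sum_congr rfl fun n _ => ?_
  rw [← prod_sub_prod_telescope]
  ring

/-- Term `0` of the telescoping is the pure-Möbius term: `telescopeTermSum … 0 = moebiusTermSum …`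
(re-proof of the skeleton's `telescopeTermSum_zero`). -/
theorem telescopeTermSum_zero' {k : ℕ} (Ψ : Fin (k + 1) → AffLinForm 1) (K : Set (Fin 1 → ℝ))
    (N : ℕ) (R : Fin (k + 1) → ℝ) : telescopeTermSum Ψ K N R 0 = moebiusTermSum Ψ K N R := by
  unfold telescopeTermSum moebiusTermSum
  refine Finset.sum_congr rfl fun n _ => ?_
  have h0 : Finset.Iio (0 : Fin (k + 1)) = ∅ := Finset.eq_empty_of_forall_notMem fun j hj => by
    have := Finset.mem_Iio.mp hj
    exact absurd this (Fin.not_lt_zero j)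
  rw [h0, Finset.prod_empty, one_mul, Fin.prod_Ioi_zero]

/-- **S2 — the assembly (registered stub `stub_assembly`).** Pointwise telescoping
`∏_i Λ(ψ_i) = ∏_i Λ_{R_i}(ψ_i) + ∑_j [∏_{i<j} Λ][Λ − Λ_{R_j}][∏_{i>j} Λ_{R_i}]`
(`vonMangoldtSum = truncCorrSum + ∑_j telescopeTermSum … j`, term `0` = `moebiusTermSum`), the choice
of geometric exponents `δ_i = (1/8) x^i`, `x = 1/(c + 1)`, `c = 2 + ∑_j 1/η_j` (so
`StaggeredBy (2 + 1/η_j)` for every `j` by `staggeredBy_mono`, `2∑_{i≥1}δ_i < δ_0`, `∑ δ_i ≤ 1/4`),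
and `ε/3` bookkeeping with `β_∞𝔖 ≥ 0` (`mass_nonneg`). -/
theorem stub_assembly : ∀ k : ℕ, TruncatedMainTerm (k + 1) → MoebiusTermBound k →
    (∀ j : Fin (k + 1), j ≠ 0 → ∃ η : ℝ, 0 < η ∧ TermBound k j η) → RelDimOneSlice (k + 1) := by
  intro k hT hM hS L ε hε
  -- Step 1: the Möbius-dilation exponents `η j` (with the dummy value `η 0 = 1`).
  have hS' : ∀ j : Fin (k + 1), ∃ η : ℝ, 0 < η ∧ (j ≠ 0 → TermBound k j η) := by
    intro j
    by_cases hj : j = 0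
    · exact ⟨1, one_pos, fun h => absurd hj h⟩
    · obtain ⟨η, hη, hTη⟩ := hS j hj
      exact ⟨η, hη, fun _ => hTη⟩
  choose η hηpos hηT using hS'
  -- Step 2: the staggering ratio `c = 2 + ∑_j 1/η_j` and the geometric exponents `δ_i = x^i/8`.
  set S : ℝ := ∑ j, 1 / η j with hS_def
  have hinv : ∀ j, 0 ≤ 1 / η j := fun j => (one_div_pos.mpr (hηpos j)).le
  have hSj : ∀ j, 1 / η j ≤ S := fun j =>
    Finset.single_le_sum (f := fun j => 1 / η j) (fun i _ => hinv i) (Finset.mem_univ j)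
  have hS0 : 0 < S := (one_div_pos.mpr (hηpos 0)).trans_le (hSj 0)
  set c : ℝ := 2 + S with hc_def
  have hc2 : 2 < c := by linarith
  have hc0 : 0 < c := by linarith
  set x : ℝ := 1 / (c + 1) with hx_def
  have hx0 : 0 < x := by positivity
  have hcx : c * x = 1 - x := by
    rw [hx_def]
    field_simp
    ring
  have hx3 : x ≤ 1 / 3 := by
    rw [hx_def]
    exact one_div_le_one_div_of_le (by norm_num) (by linarith)
  have hx1 : x < 1 := by linarith
  set δ : Fin (k + 1) → ℝ := fun i => 1 / 8 * x ^ (i : ℕ) with hδ_def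
  have hδpos : ∀ i, 0 < δ i := fun i => by positivity
  have hδnn : ∀ i, 0 ≤ δ i := fun i => (hδpos i).le
  -- geometric tails: `c ∑_{j>i} x^j ≤ x^i`
  have htail : ∀ i : Fin (k + 1), c * ∑ j ∈ Finset.Ioi i, x ^ (j : ℕ) ≤ x ^ (i : ℕ) := by
    intro i
    have hmap : ∑ j ∈ Finset.Ioi i, x ^ (j : ℕ) = ∑ m ∈ Finset.Ico ((i : ℕ) + 1) (k + 1), x ^ m := by
      rw [Finset.Ico_add_one_left_eq_Ioo, ← Fin.map_valEmbedding_Ioi, Finset.sum_map]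
      rfl
    have hgeom : ∑ j ∈ Finset.Ioi i, x ^ (j : ℕ) ≤ x ^ ((i : ℕ) + 1) / (1 - x) := by
      rw [hmap]
      exact geom_sum_Ico_le_of_lt_one hx0.le hx1
    have hx0' : x ≠ 0 := hx0.ne'
    have hc0' : c ≠ 0 := hc0.ne'
    calc c * ∑ j ∈ Finset.Ioi i, x ^ (j : ℕ) ≤ c * (x ^ ((i : ℕ) + 1) / (1 - x)) :=
          mul_le_mul_of_nonneg_left hgeom hc0.le
      _ = x ^ (i : ℕ) := by
          rw [← hcx, pow_succ]
          field_simp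
  have hstag : StaggeredBy c δ := by
    intro i
    have h := htail i
    calc c * ∑ j ∈ Finset.Ioi i, δ j = 1 / 8 * (c * ∑ j ∈ Finset.Ioi i, x ^ (j : ℕ)) := by
          rw [hδ_def, ← Finset.mul_sum]
          ring
      _ ≤ 1 / 8 * x ^ (i : ℕ) := by linarith
      _ = δ i := rfl
  have hstag2 : StaggeredBy 2 δ := staggeredBy_mono hδnn hc2.le hstag
  have hstagj : ∀ j, StaggeredBy (2 + 1 / η j) δ := fun j =>
    staggeredBy_mono hδnn (by linarith [hSj j]) hstag
  -- T0''s hypothesis `2 ∑_{i ≥ 1} δ_i < δ_0`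
  have hM' : 2 * (∑ i : Fin k, δ i.succ) < δ 0 := by
    rw [← Fin.sum_Ioi_zero]
    have h := hstag 0
    have hpos : 0 < δ 0 := hδpos 0
    have hsum_nn : 0 ≤ ∑ j ∈ Finset.Ioi (0 : Fin (k + 1)), δ j :=
      Finset.sum_nonneg fun j _ => hδnn j
    rw [← not_le]
    intro hcon
    have h1 : (c - 2) * ∑ j ∈ Finset.Ioi (0 : Fin (k + 1)), δ j ≤ 0 := by linarith
    have h2 : 0 < ∑ j ∈ Finset.Ioi (0 : Fin (k + 1)), δ j := by linarith
    have h3 : 0 < (c - 2) * ∑ j ∈ Finset.Ioi (0 : Fin (k + 1)), δ j := mul_pos (by linarith) h2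
    linarith
  -- total `∑ δ_i ≤ (1/8) · 1/(1 − x) ≤ 3/16 ≤ 1/4`
  have hsumδ : ∑ i, δ i ≤ 1 / 4 := by
    have h1 : ∑ i, δ i = 1 / 8 * ∑ m ∈ Finset.range (k + 1), x ^ m := by
      rw [Finset.mul_sum]
      exact Fin.sum_univ_eq_sum_range (fun m => 1 / 8 * x ^ m) (k + 1)
    have h2 : ∑ m ∈ Finset.range (k + 1), x ^ m ≤ 1 / (1 - x) := by
      have := geom_sum_Ico_le_of_lt_one hx0.le hx1 (m := 0) (n := k + 1)
      rwa [pow_zero, ← Finset.range_eq_Ico] at this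
    have h3 : 1 / (1 - x) ≤ 3 / 2 := by
      rw [div_le_div_iff₀ (by linarith) (by norm_num)]
      linarith
    rw [h1]
    linarith [h2.trans h3]
  -- Step 3: thresholds.
  have hε3 : 0 < ε / 3 := by positivity
  obtain ⟨N₁, hN₁⟩ := hT L δ hδpos hstag2 hsumδ (ε / 3) hε3
  obtain ⟨N₂, hN₂⟩ := hM L δ hδpos hM' hsumδ (ε / 3) hε3
  have hk1 : (0 : ℝ) < (k : ℝ) + 1 := by positivity
  have hε' : 0 < ε / 3 / ((k : ℝ) + 1) := by positivity
  have hNj : ∀ j : Fin (k + 1), ∃ Nj : ℕ, j ≠ 0 → ∀ N : ℕ, Nj ≤ N →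
      ∀ Ψ : Fin (k + 1) → AffLinForm 1, IsNondegenerateSystem Ψ → affLinSize Ψ N ≤ L →
      ∀ K : Set (Fin 1 → ℝ), Convex ℝ K → K ⊆ realBox 1 N →
        |telescopeTermSum Ψ K N (fun i => (N : ℝ) ^ (δ i)) j| ≤ ε / 3 / ((k : ℝ) + 1) * N := by
    intro j
    by_cases hj : j = 0
    · exact ⟨0, fun h => absurd hj h⟩
    · obtain ⟨Nj, hNj⟩ := hηT j hj L δ hδpos (hstagj j) hsumδ _ hε'
      exact ⟨Nj, fun _ => hNj⟩
  choose Nj hNj using hNj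
  refine ⟨max N₁ (max N₂ (Finset.univ.sup Nj)), fun N hN Ψ hΨ hsize K hK hKbox => ?_⟩
  have hN1 : N₁ ≤ N := le_of_max_le_left hN
  have hN2 : N₂ ≤ N := le_of_max_le_left (le_of_max_le_right hN)
  have hN3 : ∀ j, Nj j ≤ N := fun j =>
    (Finset.le_sup (f := Nj) (Finset.mem_univ j)).trans (le_of_max_le_right (le_of_max_le_right hN))
  -- Step 4: the `ε/3` bookkeeping.
  have h1 := hN₁ N hN1 Ψ hΨ hsize K hK hKbox
  have h2 := hN₂ N hN2 Ψ hΨ hsize K hK hKbox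
  have h3 : ∀ i : Fin k,
      |telescopeTermSum Ψ K N (fun i => (N : ℝ) ^ (δ i)) i.succ| ≤ ε / 3 / ((k : ℝ) + 1) * N :=
    fun i => hNj i.succ (Fin.succ_ne_zero i) N (hN3 _) Ψ hΨ hsize K hK hKbox
  have hM0 := mass_nonneg hΨ K
  have hN0 : (0 : ℝ) ≤ (N : ℝ) := Nat.cast_nonneg N
  rw [vonMangoldtSum_eq_truncCorrSum_add_sum Ψ K N (fun i => (N : ℝ) ^ (δ i)), Fin.sum_univ_succ,
    telescopeTermSum_zero']
  set R : Fin (k + 1) → ℝ := fun i => (N : ℝ) ^ (δ i) with hR_def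
  set β : ℝ := archFactor Ψ K * singularProduct Ψ with hβ_def
  set T : ℝ := truncCorrSum Ψ K N R with hT_def
  set M : ℝ := moebiusTermSum Ψ K N R with hM_def
  set E : ℝ := ∑ i : Fin k, telescopeTermSum Ψ K N R i.succ with hE_def
  have h4 : |E| ≤ ε / 3 * N := by
    calc |E| ≤ ∑ i : Fin k, |telescopeTermSum Ψ K N R i.succ| := Finset.abs_sum_le_sum_abs _ _
      _ ≤ ∑ _i : Fin k, ε / 3 / ((k : ℝ) + 1) * N := Finset.sum_le_sum fun i _ => h3 i
      _ = (k : ℝ) * (ε / 3 / ((k : ℝ) + 1) * N) := by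
          rw [Finset.sum_const, Finset.card_univ, Fintype.card_fin, nsmul_eq_mul]
      _ = (k : ℝ) / ((k : ℝ) + 1) * (ε / 3 * N) := by
          field_simp
      _ ≤ 1 * (ε / 3 * N) :=
          mul_le_mul_of_nonneg_right ((div_le_one hk1).mpr (by linarith)) (by positivity)
      _ = ε / 3 * N := one_mul _
  rw [show T + (M + E) - β = (T - β) + M + E by ring]
  calc |(T - β) + M + E| ≤ |(T - β) + M| + |E| := abs_add_le _ _
    _ ≤ |T - β| + |M| + |E| := by gcongr; exact abs_add_le _ _
    _ ≤ ε / 3 * (β + N) + ε / 3 * N + ε / 3 * N := add_le_add (add_le_add h1 h2) h4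
    _ ≤ ε * (β + N) := by nlinarith [mul_nonneg hε.le hM0]

end Summit.Parity.GeneralizedHardyLittlewood.Cruxes.RelativeDimOne.SingleMoebiusSplit
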